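import Summits.Parity.GeneralizedHardyLittlewood.Theses.LZZCertificateReplay
import Literature.NumberTheory.LFunctions.NoRealZeroCertificateReplayLightRows

/-!
# Route `LZZCertificateReplay` — item `LightRows` (stmt-Parity-19293): the LIGHT layer of the kernel replay

`LightRows = CertifiedRange (1/5) 23 400000 heavyList15`: every fundamental discriminant `23 < |D| ≤ 4·10⁵` outside
`heavyList15` carries a Lu–Zaman–Zhao Table-1 certificate (`λ = 1.6`, `c = 1/5`). Proof: the Literature theorem
`lzzReplayK_lightRows` (`NoRealZeroCertificateReplayLightRows.lean`), itself the `CertifiedRange.append` of the 354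
kernel-certified windows `NoRealZeroCertificateReplayRange001 … 354.lean` (`decide +kernel` over `table15`,
standard axioms). Nothing is computed here.
-/

namespace Summit.Parity.GeneralizedHardyLittlewood.Theorems

open Summit.Parity.GeneralizedHardyLittlewood.Theses

/-- **`LightRows` holds** (item stmt-Parity-19293). -/
theorem lightRows_holds : LZZCertificateReplay.LightRows :=
  Literature.NumberTheory.LFunctions.LuZamanZhao2026.Replay.lzzReplayK_lightRows

end Summit.Parity.GeneralizedHardyLittlewood.Theorems
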